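import Mathlib.CategoryTheory.Types.Basic
import Literature.AnabelianGeometry.SemiGraphs.QuasiTemperoidsQDPairs
import HarnessLib

/-!
# Semi-graphs of anabelioids, Appendix: Definition A.3 (iii) — quotients of QD-pairs
# (kernel closure census of the predicate `QDPair.IsQuotient`)

Mochizuki, *Semi-graphs of anabelioids*, Publ. RIMS **42** (2006) 221–322, Appendix
"Quasi-temperoids", Definition A.3 (iii), manuscript p. 82 [cite: MochizukiSemiAnbd2006, Def A.3(iii) p.82]:
"Let `(A, Γ_A)` be a QD-pair. Then we shall say that an arrow `φ : A → B` of `Q` *forms a quotient*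
of this QD-pair — and write `B ≅ A/Γ_A` — if the following two properties are satisfied:
(a) `φ ∘ γ_A = φ`, `∀ γ_A ∈ Γ_A`; (b) for every arrow `ψ_A : A → C` satisfying `ψ_A ∘ γ_A = ψ_A`,
`∀ γ_A ∈ Γ_A`, there exists a unique arrow `ψ_B : B → C` such that `ψ_B ∘ φ = ψ_A`."

PROOF-ONLY companion of `QuasiTemperoidsQDPairs.lean` (no definitions; sibling of
`QuasiTemperoidsQDPairsWeaklyConnected.lean`, `QuasiTemperoidsQDPairsComponents.lean`,
`QuasiTemperoidsNondegenerateObj.lean`). The declaration `QDPair.IsQuotient` is a PREDICATE on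
arrows out of a QD-pair (a definition, [SemiAnbd] Def. A.3 (iii)), not a published theorem; it
sits in the abc-iut cell's frozen fact list as row F-1628 (labelled "model-witness" by a
conclusion-head match). This file records in the kernel what there is to know about it in an
ARBITRARY category:

* `QDPair.IsQuotient.hom_ext` — clause (b) makes a quotient arrow right-cancellable (two arrows out
  of `B` that agree after `φ` coincide; cf. `QDPair.IsQuotient.epi` in
  `QuasiTemperoidsQuotientConnectedProofs.lean`), whence the negative criterion
  `QDPair.not_isQuotient_of_ne`;
* `QDPair.isQuotient_id_iff` — the identity `𝟙_A` forms a quotient of `(A, Γ_A)` iff `Γ_A` acts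
  trivially; so `QDPair.isQuotient_id_of_eq_bot` / `QDPair.isQuotient_id_bot` (`(A, {1})`,
  hypothesis-free, ANY category — these are the QD-pairs produced by the first functor `Q_i → D_i`
  of the proof of Thm. A.4, which in print's words "maps an object `B` of `Q_i` to the QD-pair
  `(B, {1})`" (p. 85); the lemma records that the identity then exhibits `B ≅ B/{1}`; the
  `B^temp(Π)` instances of record are `QDPair.isQuotient_orbitQuotientπ` and
  `isQuotient_id_trivialPair`) and `QDPair.not_isQuotient_id_of_ne` (a non-trivial `γ_A ∈ Γ_A`
  obstructs);
* `QDPair.not_isQuotient_const` — in the category of types the constant arrow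
  `PUnit → ULift Bool` does not form a quotient of `(PUnit, Γ)` for any `Γ` (it is not
  right-cancellable); hence the UNIVERSAL CLOSURE of the predicate is FALSE
  (`QDPair.not_forall_isQuotient`), while `QDPair.exists_isQuotient_and_exists_not_isQuotient`
  records that out of one QD-pair some arrows form a quotient and some do not — the row is a schema
  to be used at instances, not an assumption to bind unapplied.

Nothing here bears on, or takes a side on, [IUTchIII] Cor. 3.12; typed ≠ proved.
-/

open CategoryTheory

namespace Literature.AnabelianGeometry.SemiGraphs

universe v₁ u₁ u

section AnyCategory

variable {Q : Type u₁} [Category.{v₁} Q]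

/-- **Definition A.3 (iii) (b), uniqueness half**: a quotient arrow `φ : A → B ≅ A/Γ_A` is
right-cancellable — two arrows `a, b : B → C` with `φ ≫ a = φ ≫ b` are two factorisations of the
`Γ_A`-invariant arrow `φ ≫ a`, hence equal. [cite: MochizukiSemiAnbd2006, Def A.3(iii) p.82] -/
theorem QDPair.IsQuotient.hom_ext {P : QDPair Q} {B C : Q} {φ : P.A ⟶ B} (h : P.IsQuotient φ)
    {a b : B ⟶ C} (hab : φ ≫ a = φ ≫ b) : a = b := by
  have hψ : ∀ γ ∈ P.Γ, γ.hom ≫ (φ ≫ a) = φ ≫ a := fun γ hγ => by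
    rw [← Category.assoc, h.1 γ hγ]
  obtain ⟨ψ', -, huniq⟩ := h.2 (φ ≫ a) hψ
  exact (huniq a rfl).trans (huniq b hab.symm).symm

/-- Negative criterion from Definition A.3 (iii) (b): if two DISTINCT arrows `a ≠ b : B → C` agree
after `φ`, then `φ` does not form a quotient of `(A, Γ_A)` (for any `Γ_A`).
[cite: MochizukiSemiAnbd2006, Def A.3(iii) p.82] -/
theorem QDPair.not_isQuotient_of_ne {P : QDPair Q} {B C : Q} {φ : P.A ⟶ B} {a b : B ⟶ C}
    (hab : φ ≫ a = φ ≫ b) (hne : a ≠ b) : ¬ P.IsQuotient φ :=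
  fun h => hne (h.hom_ext hab)

/-- **Definition A.3 (iii) at the identity**: `𝟙_A : A → A` forms a quotient of the QD-pair
`(A, Γ_A)` iff every `γ_A ∈ Γ_A` is the identity — clause (a) reads `γ_A = 𝟙_A`, and clause (b)
then holds trivially (`ψ_B := ψ_A`). [cite: MochizukiSemiAnbd2006, Def A.3(iii) p.82] -/
theorem QDPair.isQuotient_id_iff (P : QDPair Q) :
    P.IsQuotient (𝟙 P.A) ↔ ∀ γ ∈ P.Γ, γ.hom = 𝟙 P.A := by
  constructor
  · intro h γ hγ
    simpa only [Category.comp_id] using h.1 γ hγ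
  · intro h
    refine ⟨fun γ hγ => by rw [h γ hγ, Category.id_comp], fun C ψ _ => ⟨ψ, Category.id_comp ψ, ?_⟩⟩
    intro ψ' hψ'
    simpa only [Category.id_comp] using hψ'

/-- A QD-pair `(A, Γ_A)` with `Γ_A = {1}` has the identity as a quotient, `A ≅ A/{1}` — in ANY
category, with no hypothesis. Such pairs are the values of the first functor `Q_i → D_i` in the
proof of Thm. A.4, which "maps an object `B` of `Q_i` to the QD-pair `(B, {1})`" (p. 85, quoted in
print's direction); this lemma records that the quotient of that pair is `B` itself, via `𝟙_B`
(the `B^temp(Π)` form is `QDPair.isQuotient_id_trivialPair`).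
[cite: MochizukiSemiAnbd2006, Def A.3(iii) p.82] -/
theorem QDPair.isQuotient_id_of_eq_bot (P : QDPair Q) (hP : P.Γ = ⊥) : P.IsQuotient (𝟙 P.A) :=
  P.isQuotient_id_iff.mpr fun γ hγ => by
    rw [hP, Subgroup.mem_bot] at hγ
    subst hγ
    rfl

/-- `A ≅ A/{1}` via the identity, for every object `A` of every category (non-vacuity of the
predicate `QDPair.IsQuotient` at the QD-pair `(A, {1})`).
[cite: MochizukiSemiAnbd2006, Def A.3(iii) p.82] -/
theorem QDPair.isQuotient_id_bot (A : Q) : (⟨A, ⊥⟩ : QDPair Q).IsQuotient (𝟙 A) :=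
  QDPair.isQuotient_id_of_eq_bot ⟨A, ⊥⟩ rfl

/-- Conversely, a NON-identity `γ_A ∈ Γ_A` prevents `𝟙_A` from forming a quotient of `(A, Γ_A)`
(clause (a) fails). [cite: MochizukiSemiAnbd2006, Def A.3(iii) p.82] -/
theorem QDPair.not_isQuotient_id_of_ne {P : QDPair Q} {γ : Aut P.A} (hγ : γ ∈ P.Γ)
    (hne : γ.hom ≠ 𝟙 P.A) : ¬ P.IsQuotient (𝟙 P.A) :=
  fun h => hne (P.isQuotient_id_iff.mp h γ hγ)

end AnyCategory

section Types

/-- In the category of types, the constant arrow `PUnit → ULift Bool` with value `true` does NOT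
form a quotient of the QD-pair `(PUnit, Γ)`, whatever `Γ`: the identity of `ULift Bool` and the
constant map `true` agree after it but differ at `false` (clause (b) of Def. A.3 (iii) fails).
[cite: MochizukiSemiAnbd2006, Def A.3(iii) p.82] -/
theorem QDPair.not_isQuotient_const (Γ : Subgroup (Aut (PUnit.{u + 1} : Type u))) :
    ¬ (⟨PUnit.{u + 1}, Γ⟩ : QDPair (Type u)).IsQuotient
        (↾(fun _ => ULift.up true) : (PUnit.{u + 1} : Type u) ⟶ ULift.{u} Bool) := by
  refine QDPair.not_isQuotient_of_ne (C := ULift.{u} Bool) (a := 𝟙 (ULift.{u} Bool))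
    (b := ↾fun _ => ULift.up true) (by ext; rfl) fun h => ?_
  have h' := types_congr_hom h (ULift.up false)
  exact Bool.false_ne_true (ULift.up.inj h')

/-- F-1628 is a PREDICATE, not a theorem: its universal closure is FALSE — in the category of
types the constant arrow `PUnit → ULift Bool` does not form a quotient of the QD-pair
`(PUnit, {1})`. [cite: MochizukiSemiAnbd2006, Def A.3(iii) p.82] -/
theorem QDPair.not_forall_isQuotient :
    ¬ ∀ (Q : Type (u + 1)) [Category.{u} Q] (P : QDPair Q) (B : Q) (φ : P.A ⟶ B),
      P.IsQuotient φ :=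
  fun h => QDPair.not_isQuotient_const.{u} ⊥
    (h (Type u) ⟨PUnit.{u + 1}, ⊥⟩ (ULift.{u} Bool) (↾fun _ => ULift.up true))

/-- The predicate separates arrows out of ONE QD-pair: for `(PUnit, {1})` in the category of types
the identity forms a quotient while the constant arrow to `ULift Bool` does not — so F-1628 is a
schema to be instantiated (instances of record: `QDPair.isQuotient_orbitQuotientπ` in `B^temp(Π)`),
neither empty nor universally true. [cite: MochizukiSemiAnbd2006, Def A.3(iii) p.82] -/
theorem QDPair.exists_isQuotient_and_exists_not_isQuotient :
    ∃ P : QDPair (Type u), (∃ (B : Type u) (φ : P.A ⟶ B), P.IsQuotient φ) ∧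
      ∃ (B : Type u) (φ : P.A ⟶ B), ¬ P.IsQuotient φ :=
  ⟨⟨PUnit.{u + 1}, ⊥⟩, ⟨PUnit.{u + 1}, 𝟙 _, QDPair.isQuotient_id_bot _⟩,
    ⟨ULift.{u} Bool, ↾fun _ => ULift.up true, QDPair.not_isQuotient_const.{u} ⊥⟩⟩

end Types

end Literature.AnabelianGeometry.SemiGraphs
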